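import Summits.BirchSwinnertonDyer.BirchSwinnertonDyer.Theorems.PrintCFramBottomClassIndexLawFiveLeHerbrandKummerReflectionCountCharacters
import Literature.FieldTheory.Kummer.KummerEigenDescent
import Mathlib.FieldTheory.Galois.Infinite
import HarnessLib

/-!
# Route `PrintCFram`, crux C2 `BottomClassIndexLawFiveLe` (stmt-BirchSwinnertonDyer-20372), line
# `eisenstein-resource-bdp-line` (registry v19/v20, B1 first-order census): **THE KUMMER CHARACTER OF A RADICAL IN
# `Γ_K`-CURRENCY** — for `K ∋ ζ_p` and `α ∈ K^×`, the character `κ_α : Γ_K →* ℤ/p`, `σ(α^{1/p}) = ζ^{κ_α(σ)} α^{1/p}`, has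
# open kernel, is trivial iff `α ∈ K^{×p}`, and kills the inertia groups above every `v ∤ p` at which `α` is a unit
# (cell `bsd-print-cfram`, width seat `bsd-line-cfram-p1-w7` g4; helper `--supports` 20372; 0 defs, 0 facts, 0 sorry)

HONEST FRAMING. Nothing about BSD is proved here, no stub is closed; elementary Kummer theory in the currency of w2 g9's bridge
`SelmerCount.exists_characters_natCard_h1Unramified_le` (characters `κ : absoluteGaloisGroup K →* Multiplicative (ZMod p)`, open
kernel, killing `𝔔.inertia Γ_K` above the places outside `S`, `χ̄`-equivariant under `absGaloisOuterConj`): the CONSTRUCTIVE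
direction «radical ↦ admissible character» of the Leopoldt LOWER bound «EVEN-IRREGULAR ⟹ #R_rel(ψ) ≥ p²» (w2 g10's successor item,
HOME/STATUS 00:00:48Z); its first radical is the Minkowski unit of `Literature…UnitGalois.exists_even_eigenunit` (this seat).
* §1 `exists_kummer_character` (`K ∋ ζ` a field, `β^p = α ≠ 0`: `κ : Γ_K →* Multiplicative (ZMod p)` with `σ • β = ζ^{(κ σ).val} β`),
  `kummer_character_eq_one_iff` (`κ = 1 ↔ β ∈ K`); §2 `isOpen_ker_kummer_character`; §3 **`kummer_character_eq_one_of_mem_inertia`**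
  (`α ∈ 𝓞_K`, `α ∉ v`, `v ∤ p` ⊢ `κ` kills `𝔔.inertia Γ_K` for `𝔔 ∣ v`). The
  equivariance under `absGaloisOuterConj` (the bridge's `heq`) is the sequel file `…KummerRadicalCharacterEquivariance.lean`.
THEOREMS ONLY; no definition, no named fact, no `sorry`. BSD is not proved by any of this. References: [NeukirchANT1999] Ch. IV §3,
Ch. I §9; [Washington1997] §10.2 (the Kummer pairing in the reflection theorem); [Lang1990] Ch. 13 §2.
-/

set_option autoImplicit false
-- `…BirchSwinnertonDyer.BirchSwinnertonDyer.Theorems…` is the problem's mandated namespace (D-0017).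
set_option linter.dupNamespace false

noncomputable section

namespace Summit.BirchSwinnertonDyer.BirchSwinnertonDyer.Theorems.PrintCFram.KummerRadical

open Literature.NumberTheory.NumberFields Literature.NumberTheory.GaloisRepresentations Literature.FieldTheory.Kummer
open NumberField IsDedekindDomain Field
open scoped nonZeroDivisors Pointwise IntermediateField

/-! ## §1 The Kummer character of a `p`-th root -/

section Character

variable {K : Type} [Field K] {p : ℕ} [hp : Fact p.Prime]

/-- **The Kummer character of a radical.** `K` a field containing a primitive `p`-th root of unity `ζ`, `β ∈ K̄` with
`β^p = α` for some `α ∈ K^×`. Then there is a homomorphism `κ : Γ_K →* ℤ/p` (multiplicative notation) with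
**`σ • β = ζ^{(κ σ).val} · β`** for every `σ ∈ Γ_K = Gal(K̄/K)` (`σβ/β` is a `p`-th root of unity, fixed by `Γ_K`, so `σ ↦ σβ/β`
is a homomorphism). [folklore] -/
theorem exists_kummer_character {ζ : K} (hζ : IsPrimitiveRoot ζ p) {α : K} (hα : α ≠ 0)
    {β : AlgebraicClosure K} (hβ : β ^ p = algebraMap K (AlgebraicClosure K) α) :
    ∃ κ : absoluteGaloisGroup K →* Multiplicative (ZMod p),
      ∀ σ : absoluteGaloisGroup K,
        σ • β = algebraMap K (AlgebraicClosure K) ζ ^ ((κ σ).toAdd : ZMod p).val * β := by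
  haveI : NeZero p := ⟨hp.out.ne_zero⟩
  set ζ' := algebraMap K (AlgebraicClosure K) ζ with hζ'
  have hζ'p : IsPrimitiveRoot ζ' p := hζ.map_of_injective (algebraMap K (AlgebraicClosure K)).injective
  have hβ0 : β ≠ 0 := fun h => by
    rw [h, zero_pow hp.out.ne_zero, eq_comm, map_eq_zero] at hβ; exact hα hβ
  -- every `σ β` is `ζ^i β`
  have hex : ∀ σ : absoluteGaloisGroup K, ∃ i : ℕ, i < p ∧ σ • β = ζ' ^ i * β := by
    intro σ
    have h1 : (σ • β) ^ p = β ^ p := by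
      rw [← smul_pow', hβ, absoluteGaloisGroup.smul_def, AlgEquiv.commutes]
    obtain ⟨i, hi, h⟩ := exists_eq_pow_mul_of_pow_eq hζ'p hβ0 h1
    exact ⟨i, hi, h⟩
  choose i hi hiβ using hex
  -- uniqueness mod `p`
  have huniq : ∀ (σ : absoluteGaloisGroup K) (j : ℕ), σ • β = ζ' ^ j * β → (j : ZMod p) = (i σ : ZMod p) := by
    intro σ j hj
    rw [hiβ σ] at hj
    have h2 : ζ' ^ j = ζ' ^ i σ := mul_right_cancel₀ hβ0 hj.symm
    exact (ZMod.natCast_eq_natCast_iff _ _ _).2 (modEq_of_pow_eq_pow hζ'p h2)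
  refine ⟨{ toFun := fun σ => Multiplicative.ofAdd (i σ : ZMod p), map_one' := ?_, map_mul' := fun σ τ => ?_ },
    fun σ => ?_⟩
  · have h := huniq 1 0 (by rw [one_smul, pow_zero, one_mul])
    rw [Nat.cast_zero] at h
    rw [← h, ofAdd_zero]
  · -- `(στ) β = σ (ζ^{i τ} β) = ζ^{i τ} ζ^{i σ} β`
    have h : (σ * τ) • β = ζ' ^ (i τ + i σ) * β := by
      rw [mul_smul, hiβ τ, smul_mul', smul_pow', hζ', absoluteGaloisGroup.smul_def σ (algebraMap K _ ζ),
        AlgEquiv.commutes, ← hζ', hiβ σ, pow_add, mul_assoc]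
    have h2 := huniq (σ * τ) _ h
    rw [← ofAdd_add, ← Nat.cast_add, add_comm, h2]
  · change σ • β = ζ' ^ ((Multiplicative.ofAdd (i σ : ZMod p)).toAdd : ZMod p).val * β
    rw [toAdd_ofAdd, ZMod.val_natCast, Nat.mod_eq_of_lt (hi σ)]
    exact hiβ σ

/-- **`κ = 1 ↔ β ∈ K`**: the Kummer character is trivial iff the radical is fixed by `Γ_K`, i.e. (`K̄/K` Galois) lies in `K` —
then `α = β^p ∈ K^{×p}`. [folklore] -/
theorem kummer_character_eq_one_iff [CharZero K] {ζ : K} (hζ : IsPrimitiveRoot ζ p) {α : K} (hα : α ≠ 0)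
    {β : AlgebraicClosure K} (hβ : β ^ p = algebraMap K (AlgebraicClosure K) α)
    (κ : absoluteGaloisGroup K →* Multiplicative (ZMod p))
    (hκ : ∀ σ : absoluteGaloisGroup K,
      σ • β = algebraMap K (AlgebraicClosure K) ζ ^ ((κ σ).toAdd : ZMod p).val * β) :
    κ = 1 ↔ β ∈ Set.range (algebraMap K (AlgebraicClosure K)) := by
  haveI : NeZero p := ⟨hp.out.ne_zero⟩
  have hβ0 : β ≠ 0 := fun h => by
    rw [h, zero_pow hp.out.ne_zero, eq_comm, map_eq_zero] at hβ; exact hα hβ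
  constructor
  · intro h1
    rw [InfiniteGalois.mem_range_algebraMap_iff_fixed]
    intro σ
    have h := hκ ((absoluteGaloisGroup.toAlgEquiv K).symm σ)
    rw [h1, MonoidHom.one_apply, toAdd_one, ZMod.val_zero, pow_zero, one_mul,
      absoluteGaloisGroup.toAlgEquiv_symm_apply] at h
    exact h
  · rintro ⟨y, hy⟩
    ext σ
    have h := hκ σ
    rw [← hy, absoluteGaloisGroup.smul_def, AlgEquiv.commutes] at h
    have hy0 : algebraMap K (AlgebraicClosure K) y ≠ 0 := by rw [hy]; exact hβ0
    have h2 : algebraMap K (AlgebraicClosure K) ζ ^ ((κ σ).toAdd : ZMod p).val = 1 := by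
      have h' := h.symm
      rw [mul_eq_right₀ hy0] at h'
      exact h'
    have hζ' : IsPrimitiveRoot (algebraMap K (AlgebraicClosure K) ζ) p :=
      hζ.map_of_injective (algebraMap K (AlgebraicClosure K)).injective
    have h3 : p ∣ ((κ σ).toAdd : ZMod p).val := hζ'.dvd_of_pow_eq_one _ h2
    have h4 : ((κ σ).toAdd : ZMod p) = 0 := by
      rw [← ZMod.natCast_zmod_val ((κ σ).toAdd), ZMod.natCast_eq_zero_iff]
      exact h3
    rw [MonoidHom.one_apply, ← ofAdd_toAdd (κ σ), h4, ofAdd_zero]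

end Character

/-! ## §2 The kernel is open -/

section Open

variable {K : Type} [Field K] {p : ℕ} [hp : Fact p.Prime]

/-- **The Kummer character has open kernel**: it contains `Gal(K̄/K(β))`, the fixing subgroup of the finite extension `K(β)`
(open in the Krull topology, Mathlib `IntermediateField.fixingSubgroup_isOpen`). [folklore] -/
theorem isOpen_ker_kummer_character {ζ : K} (hζ : IsPrimitiveRoot ζ p) {α : K} (hα : α ≠ 0)
    {β : AlgebraicClosure K} (hβ : β ^ p = algebraMap K (AlgebraicClosure K) α)
    (κ : absoluteGaloisGroup K →* Multiplicative (ZMod p))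
    (hκ : ∀ σ : absoluteGaloisGroup K,
      σ • β = algebraMap K (AlgebraicClosure K) ζ ^ ((κ σ).toAdd : ZMod p).val * β) :
    IsOpen (κ.ker : Set (absoluteGaloisGroup K)) := by
  haveI : NeZero p := ⟨hp.out.ne_zero⟩
  -- `K(β)` is finite over `K` (`β` is integral: a root of `X^p − α`)
  have hint : IsIntegral K β := by
    refine IsIntegral.of_pow hp.out.pos ?_
    rw [hβ]; exact isIntegral_algebraMap
  haveI : FiniteDimensional K K⟮β⟯ := IntermediateField.adjoin.finiteDimensional hint
  have hc : Continuous (absoluteGaloisGroup.toAlgEquiv K) := continuous_id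
  let H : Subgroup (absoluteGaloisGroup K) := K⟮β⟯.fixingSubgroup.comap (absoluteGaloisGroup.toAlgEquiv K).toMonoidHom
  have hHopen : IsOpen (H : Set (absoluteGaloisGroup K)) := (K⟮β⟯.fixingSubgroup_isOpen).preimage hc
  refine Subgroup.isOpen_mono (H₁ := H) (fun σ hσ => ?_) hHopen
  rw [MonoidHom.mem_ker]
  have hσ' : absoluteGaloisGroup.toAlgEquiv K σ ∈ K⟮β⟯.fixingSubgroup := Subgroup.mem_comap.mp hσ
  have hfix : σ • β = β := by
    rw [absoluteGaloisGroup.smul_def]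
    exact (IntermediateField.mem_fixingSubgroup_iff _ _).1 hσ' β (IntermediateField.mem_adjoin_simple_self K β)
  have hβ0 : β ≠ 0 := fun h => by
    rw [h, zero_pow hp.out.ne_zero, eq_comm, map_eq_zero] at hβ; exact hα hβ
  have h := hκ σ
  rw [hfix] at h
  have h2 : algebraMap K (AlgebraicClosure K) ζ ^ ((κ σ).toAdd : ZMod p).val = 1 := by
    have h' := h.symm
    rw [mul_eq_right₀ hβ0] at h'
    exact h'
  have hζ' : IsPrimitiveRoot (algebraMap K (AlgebraicClosure K) ζ) p :=
    hζ.map_of_injective (algebraMap K (AlgebraicClosure K)).injective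
  have h4 : ((κ σ).toAdd : ZMod p) = 0 := by
    rw [← ZMod.natCast_zmod_val ((κ σ).toAdd), ZMod.natCast_eq_zero_iff]
    exact hζ'.dvd_of_pow_eq_one _ h2
  rw [← ofAdd_toAdd (κ σ), h4, ofAdd_zero]

end Open

/-! ## §3 Unramified outside `p`: the inertia groups above `v ∤ p` die when the radicand is a `v`-unit -/

section Inertia

variable {K : Type} [Field K] [NumberField K] {p : ℕ} [hp : Fact p.Prime]

/-- `ζ^k − 1 ∈ 𝔔` with `p ∤ k` and `ζ` a primitive `p`-th root of unity forces `p ∈ 𝔔` (`ζ − 1 ∈ 𝔔` by Bezout, and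
`p = Σ_{j<p} (1 − ζ^j)` since `Σ_{j<p} ζ^j = 0`). [folklore] -/
theorem natCast_mem_of_pow_sub_one_mem {R : Type*} [CommRing R] [IsDomain R] {ζ : R} (hζ : IsPrimitiveRoot ζ p) (I : Ideal R)
    {k : ℕ} (hk : ¬ p ∣ k) (h : ζ ^ k - 1 ∈ I) : ((p : ℕ) : R) ∈ I := by
  -- `μ = ζ^k` is again a primitive `p`-th root of unity with `μ − 1 ∈ I`, and `p = Σ_{j<p} (1 − μ^j)`
  have hμ : IsPrimitiveRoot (ζ ^ k) p := hζ.pow_of_coprime k ((Nat.Prime.coprime_iff_not_dvd hp.out).2 hk).symm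
  have h2 : ∀ j : ℕ, 1 - (ζ ^ k) ^ j ∈ I := fun j => by
    obtain ⟨c, hc⟩ := sub_dvd_pow_sub_pow 1 (ζ ^ k) j
    rw [one_pow] at hc
    rw [hc]
    exact I.mul_mem_right c (by rw [← neg_sub]; exact I.neg_mem h)
  have hsum : ∑ j ∈ Finset.range p, (1 - (ζ ^ k) ^ j) = (p : R) := by
    rw [Finset.sum_sub_distrib, hμ.geom_sum_eq_zero hp.out.one_lt, sub_zero, Finset.sum_const, Finset.card_range,
      nsmul_eq_mul, mul_one]
  rw [← hsum]
  exact I.sum_mem fun j _ => h2 j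

omit [NumberField K] in
/-- **The Kummer character kills the inertia above `v ∤ p` when the radicand is a `v`-unit.** `K` a number field with a
primitive `p`-th root of unity `ζ`, `α ∈ 𝓞_K` with `α ∉ v` for a place `v ∤ p`, `β^p = α` in `K̄`, `κ` its Kummer character;
`𝔔` a prime of `\bar ℤ_K` above `v` and `g` in its inertia group. Then `κ g = 1`: from `g • β − β = (ζ^k − 1) β ∈ 𝔔` and
`β ∉ 𝔔` (`β^p = α ∉ v = 𝔔 ∩ 𝓞_K`) we get `ζ^k − 1 ∈ 𝔔`, hence `p ∈ 𝔔 ∩ 𝓞_K = v` unless `p ∣ k` — the unramifiedness of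
`K(α^{1/p})/K` at `v ∤ pα` read on `Γ_K`. [folklore] -/
theorem kummer_character_eq_one_of_mem_inertia {ζ : K} (hζ : IsPrimitiveRoot ζ p) {α : 𝓞 K}
    {β : AlgebraicClosure K} (hβ : β ^ p = algebraMap K (AlgebraicClosure K) (α : K))
    (κ : absoluteGaloisGroup K →* Multiplicative (ZMod p))
    (hκ : ∀ σ : absoluteGaloisGroup K,
      σ • β = algebraMap K (AlgebraicClosure K) ζ ^ ((κ σ).toAdd : ZMod p).val * β)
    {v : HeightOneSpectrum (𝓞 K)} (hv : ((p : ℕ) : 𝓞 K) ∉ v.asIdeal) (hαv : α ∉ v.asIdeal)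
    {𝔔 : Ideal (absIntegers (𝓞 K) K)} (h𝔔 : 𝔔 ∈ v.primesAbove)
    {g : absoluteGaloisGroup K} (hg : g ∈ 𝔔.inertia (absoluteGaloisGroup K)) : κ g = 1 := by
  haveI : NeZero p := ⟨hp.out.ne_zero⟩
  haveI : 𝔔.IsPrime := h𝔔.1
  have hunder : v.asIdeal = 𝔔.under (𝓞 K) := h𝔔.2.over
  -- `ζ` and `β` as elements of `\bar ℤ_K`
  have hζint : IsIntegral ℤ ζ := hζ.isIntegral hp.out.pos
  set ζ₀ : 𝓞 K := ⟨ζ, hζint⟩ with hζ₀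
  have hζ₀K : ((ζ₀ : 𝓞 K) : K) = ζ := rfl
  set ζt : absIntegers (𝓞 K) K := algebraMap (𝓞 K) (absIntegers (𝓞 K) K) ζ₀ with hζt
  have hinjK : Function.Injective (algebraMap (𝓞 K) (AlgebraicClosure K)) := by
    rw [IsScalarTower.algebraMap_eq (𝓞 K) K (AlgebraicClosure K)]
    exact (algebraMap K _).injective.comp (FaithfulSMul.algebraMap_injective (𝓞 K) K)
  have hζt_coe : ((ζt : absIntegers (𝓞 K) K) : AlgebraicClosure K) = algebraMap K (AlgebraicClosure K) ζ := by
    rw [hζt, Subalgebra.coe_algebraMap]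
    exact (IsScalarTower.algebraMap_apply (𝓞 K) K (AlgebraicClosure K) ζ₀).trans rfl
  have hinj : Function.Injective (algebraMap (𝓞 K) (absIntegers (𝓞 K) K)) := by
    intro x y hxy
    have h := congrArg (fun z : absIntegers (𝓞 K) K => (z : AlgebraicClosure K)) hxy
    simp only [Subalgebra.coe_algebraMap] at h
    exact hinjK h
  have hζt_prim : IsPrimitiveRoot ζt p := by
    have h0 : IsPrimitiveRoot ζ₀ p :=
      IsPrimitiveRoot.of_map_of_injective (f := algebraMap (𝓞 K) K) (by exact hζ) RingOfIntegers.coe_injective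
    exact h0.map_of_injective hinj
  have hβ' : β ^ p = algebraMap (𝓞 K) (AlgebraicClosure K) α := by
    rw [hβ, IsScalarTower.algebraMap_apply (𝓞 K) K (AlgebraicClosure K)]
  have hβint : IsIntegral (𝓞 K) β := by
    refine IsIntegral.of_pow hp.out.pos ?_
    rw [hβ']; exact isIntegral_algebraMap
  set βt : absIntegers (𝓞 K) K := ⟨β, (mem_integralClosure_iff _ _).2 hβint⟩ with hβt
  -- `β ∉ 𝔔`
  have hα0 : ((α : 𝓞 K) : K) ≠ 0 := fun h => hαv (by
    rw [RingOfIntegers.coe_eq_zero_iff.mp h]; exact v.asIdeal.zero_mem)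
  have hβt_not : βt ∉ 𝔔 := by
    intro hmem
    have hpmem : βt ^ p ∈ 𝔔 := 𝔔.pow_mem_of_mem hmem p hp.out.pos
    have heq : βt ^ p = algebraMap (𝓞 K) (absIntegers (𝓞 K) K) α := by
      apply Subtype.ext
      change β ^ p = ((algebraMap (𝓞 K) (absIntegers (𝓞 K) K) α : absIntegers (𝓞 K) K) : AlgebraicClosure K)
      rw [hβ', Subalgebra.coe_algebraMap]
      rfl
    rw [heq] at hpmem
    have : α ∈ v.asIdeal := by rw [hunder, Ideal.under_def, Ideal.mem_comap]; exact hpmem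
    exact hαv this
  -- `g • β − β = (ζ^k − 1) β ∈ 𝔔`
  set k : ℕ := ((κ g).toAdd : ZMod p).val with hk
  have hgβ : g • βt - βt = (ζt ^ k - 1) * βt := by
    apply Subtype.ext
    change g • β - β = ((((ζt ^ k - 1) * βt : absIntegers (𝓞 K) K)) : AlgebraicClosure K)
    push_cast
    rw [hζt_coe, hκ g]
    ring
  have hmem : (ζt ^ k - 1) * βt ∈ 𝔔 := by rw [← hgβ]; exact AddSubgroup.mem_inertia.1 hg βt
  rcases (Ideal.IsPrime.mem_or_mem ‹𝔔.IsPrime› hmem) with h1 | h1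
  · -- `ζ^k − 1 ∈ 𝔔`: then `p ∣ k`, else `p ∈ 𝔔 ∩ 𝓞_K = v`
    by_contra hne
    have hk0 : ¬ p ∣ k := by
      intro hdvd
      apply hne
      have h4 : ((κ g).toAdd : ZMod p) = 0 := by
        rw [← ZMod.natCast_zmod_val ((κ g).toAdd), ZMod.natCast_eq_zero_iff]; exact hdvd
      rw [← ofAdd_toAdd (κ g), h4, ofAdd_zero]
    have hpQ : ((p : ℕ) : absIntegers (𝓞 K) K) ∈ 𝔔 := natCast_mem_of_pow_sub_one_mem hζt_prim 𝔔 hk0 h1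
    apply hv
    rw [hunder, Ideal.under_def, Ideal.mem_comap, map_natCast]
    exact hpQ
  · exact absurd h1 hβt_not

end Inertia

end Summit.BirchSwinnertonDyer.BirchSwinnertonDyer.Theorems.PrintCFram.KummerRadical

end
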